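import Mathlib.Analysis.InnerProductSpace.Basic
import Mathlib.Analysis.Convex.Function
import Mathlib.Analysis.SpecialFunctions.Complex.Log
import Mathlib.MeasureTheory.Measure.Lebesgue.Complex
import Mathlib.MeasureTheory.Measure.Prod
import Mathlib.Order.LiminfLimsup
import Mathlib.Topology.MetricSpace.Basic
import Literature.Geometry.DiscreteGeometry.UnitDiscBondAngles
import HarnessLib

/-!
# Grain-boundary energy densities of sticky-disk polycrystals (Friedrich–Kreutz–Schmidt 2021)

Topic `Literature/MathematicalPhysics/StatisticalMechanics` (namespace = path, grouping sub-namespace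
`FriedrichKreutzSchmidt2021` for the paper's vocabulary).  Source: M. Friedrich, L. Kreutz, B. Schmidt,
*Emergence of rigid polycrystals from atomistic systems with Heitmann–Radin sticky disk energy*,
Arch. Ration. Mech. Anal. **240** (2021) 627–698 = arXiv:2006.01558v2 [FriedrichKreutzSchmidt2021]
(held: the arXiv text `paper:arxiv-2006.01558` and the open-access journal PDF; page numbers below are
JOURNAL pages).  Cross-ladder literature-typing layer (D-0088 (4)), cell `crystal3d-full`, seat
`littype-FC1-2`: this paper is the two-dimensional printed template of the wall laws
`GenericWallFloor` / `CoaxialWallLaw` (items `stmt-Ventures-19480/19481`) of the venture route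
`Summit.Ventures.Crystal3D.Theses.StickyWulffConstant` — a misoriented grain boundary of sticky
disks generically costs the SUM of the two free-surface energies, and always at least ONE HALF of it.

This file types §2.1–§2.3 at the level of the CELL PROBLEM (finite configurations): the localized
energy (2.3), the boundary-value cell problem (2.16), the density `ϕ` (Proposition 2.2), the
hexagonal density `ϕ_hex` (2.18), and Theorem 2.5 (properties of `ϕ`), together with the two
structural lemmas behind it: Lemma 5.1 (i) (minimisers are subsets of the two boundary lattices —
"no interpolating boundary layers") and Lemma 6.1 (the cell minimum at scale `1` on a cube of side `T`
is within `C/T` of the density).  The `Γ`-convergence statement itself (Theorem 2.1 compactness in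
`PC(ℝ²;𝒵) ⊂ SBV`, Theorem 2.3 with `E(u) = ∫_{J_u} ϕ(u⁺,u⁻,ν_u) dH¹`) needs jump sets and traces of
`SBV` functions, which Mathlib does not have; it is NOT typed here (see "What is not here").

## Source, as printed

* p. 630, (1.3): "`E_ε(X) = ½ Σ_{x∈X} ε (6 + Σ_{y∈X∖{x}} V_sticky(|x−y|/ε))`", `V_sticky = +∞ / −1 / 0`
  for `r < 1 / r = 1 / r > 1` (1.1); p. 629, (1.2): "`min{E(X_N) : #X_N = N} = −⌊3N − √(12N−3)⌋`",
  and the normalized energy is "`(E(X_N) + 3N)/√N`", `ε = 1/√N`.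
* p. 632–633: "`N_ε(x) = {y ∈ X : |x − y| = ε}` (2.1)"; "for configurations `X` with `E_ε(X) < +∞`
  there holds `#N_ε(x) ≤ 6` for all `x ∈ X` (2.2)"; "`E_ε(X, B) = ½ Σ_{x ∈ X ∩ B} ε (6 − #N_ε(x))`
  (2.3)".
* p. 633–634: "`ν^⊥ ∈ S¹` the unit vector obtained by rotating `ν` by `π/2` in a clockwise sense";
  "we sometimes identify vectors `x ∈ ℝ²` with elements of `ℂ` … the rotation of `x ∈ ℝ²` by an angle
  `θ` is indicated by `e^{iθ}x`"; "`Q^ν = {y ∈ ℝ² : −½ ≤ ⟨y,ν⟩ < ½, −½ ≤ ⟨y,ν^⊥⟩ < ½}`";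
  "`Q^ν_ρ(x) := x + ρQ^ν`"; (2.7): "`∂^±_ε Q^ν_ρ(x) = x + {y ∈ Q^ν_{ρ+10ε} ∖ Q^ν_{ρ−10ε} : ±⟨ν, y⟩ ≥ 5ε}`";
  "`𝓛 := {p + qω : p, q ∈ ℤ}`, where `ω := ½ + (i/2)√3`"; "`𝒜` the set of rotations by angles in
  `[0, π/3)` … `𝒜 = ℝ/(π/3)ℤ`", "`𝒯 = ℝ²/𝓛`", (2.8) representatives "`λ₁ + λ₂ω : 0 ≤ λ₁ < 1, 0 ≤ λ₂ < 1`";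
  (2.9): "`𝒵 := (𝒜 × 𝒯 × {1}) ∪ {0}`", "`𝓛(z) = 𝓛(θ,τ,1) := e^{iθ}(𝓛 + τ)`", "`𝓛(0) = ∅`" (vacuum);
  (2.10): "`X` coincides with `ε𝓛(z)` on `A`, written `X = ε𝓛(z)` on `A`, if `X ∩ A = (ε𝓛(z)) ∩ A`".
* p. 636, **Proposition 2.2 (Density).** "For every `z⁺, z⁻ ∈ 𝒵`, `ν ∈ S¹`, `x₀ ∈ ℝ²`, and `ρ > 0`
  there exists
  `ϕ(z⁺,z⁻,ν) = lim_{ε→0} (1/ρ) min{E_ε(X, Q^ν_ρ(x₀)) : X = ε𝓛(z^±) on ∂^±_ε Q^ν_ρ(x₀)}` (2.16),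
  and is independent of `x₀` and `ρ`."
* p. 638, (2.18): "`ϕ_hex(ν) = (2/√3) Σ_{k=1}^{3} |⟨ν, ω^k⟩|`.  Note that `ϕ_hex` is a Finsler norm whose
  unit ball is a regular hexagon in `ℝ²` with vertices in `½e^{iπ/6}{±1, ±ω, ±ω²}`."
* p. 638, **Theorem 2.5 (Properties of `ϕ`).** "Let `ϕ` be the density given in Proposition 2.2,
  extended to a function defined on `𝒵 × 𝒵 × ℝ²` which is positively 1-homogeneous in the third
  variable. Then `ϕ` satisfies the following properties:
  (i) (Solid-vacuum energy) There holds `ϕ(z,0,ν) = ϕ(0,z,ν) = ϕ_hex(e^{−iθ}ν)` for all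
  `z = (θ,τ,1) ∈ 𝒵∖{0}` and `ν ∈ S¹`.
  (ii) (Solid-solid energy) There exists a null-set `N` in `(𝒵∖{0})²` (with respect to its
  six-dimensional Haar measure) such that for all pairs `(z⁺,z⁻) ∈ (𝒵∖{0})² ∖ N`, `z⁺ ≠ z⁻`, and
  `ν ∈ S¹` there holds `ϕ(z⁺,z⁻,ν) = ϕ_hex(e^{−iθ⁺}ν) + ϕ_hex(e^{−iθ⁻}ν)`, and for all `(z⁺,z⁻) ∈ N`,
  `z⁺ ≠ z⁻`, and `ν ∈ S¹` there holds
  `½ϕ_hex(e^{−iθ⁺}ν) + ½ϕ_hex(e^{−iθ⁻}ν) ≤ ϕ(z⁺,z⁻,ν) < ϕ_hex(e^{−iθ⁺}ν) + ϕ_hex(e^{−iθ⁻}ν)`, where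
  we write `z^± = (θ^±, τ^±, 1)`.  Moreover, there are exceptional sets `G_𝒜 ⊂ 𝒜` of angles and, for
  each `θ ∈ G_𝒜`, `G_𝒯(θ) ⊂ ℝ²` of translation vectors such that `G_𝒜` is countable and each `G_𝒯(θ)`
  is contained in a finite union of spheres, with
  `N ⊂ {(z⁺,z⁻) : θ⁺ − θ⁻ ∈ G_𝒜, e^{iθ⁺}τ⁺ − e^{iθ⁻}τ⁻ ∈ G_𝒯(θ⁺ − θ⁻)}`.
  (iii) (Convexity) The mapping `ν ↦ ϕ(z⁺,z⁻,ν)` is convex for all `z⁺, z⁻ ∈ 𝒵`.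
  (iv) (Rotational invariance) For all `z^± = (θ^±,τ^±,1)`, `ν ∈ S¹`, and `θ ∈ 𝒜` there holds
  `ϕ((θ⁺+θ, τ⁺, 1), (θ⁻+θ, τ⁻, 1), e^{iθ}ν) = ϕ((θ⁺,τ⁺,1), (θ⁻,τ⁻,1), ν)`.
  (v) (Translational invariance) For all `z^±`, `ν ∈ S¹`, and `τ ∈ 𝒯` there holds
  `ϕ((θ⁺, τ⁺ + e^{−iθ⁺}τ, 1), (θ⁻, τ⁻ + e^{−iθ⁻}τ, 1), ν) = ϕ((θ⁺,τ⁺,1), (θ⁻,τ⁻,1), ν)`."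
* p. 663, **Lemma 5.1 (Reduction to subsets of two lattices).** "Let `z⁺, z⁻ ∈ 𝒵`, `ν ∈ S¹`,
  `y ∈ ℝ²`, and `T > 0`. Let `X ⊂ ℝ²` be a minimizer of
  `min{E₁(X, Q^ν_T(y)) : X = 𝓛(z^±) on ∂^±_1 Q^ν_T(y)}` (5.3). Then … (i) (Subset of lattices) There
  holds `X = X⁺ ∪ X⁻` on `Q^ν_T(y)`, where `X^± ⊂ 𝓛(z^±)` and `X^±` is connected." (p. 662–663: "a set
  `Y ⊂ ℝ²` is connected if for each pair `x, y ∈ Y` there exists a chain `(v₁,…,v_n)` with `v_i ∈ Y`,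
  `v₁ = x`, `v_n = y`, and `|v_{i+1} − v_i| = 1`".)
* p. 673, **Lemma 6.1 (Relation of `Φ` and `ϕ_hex`).** "There exists a universal constant `C > 0`
  such that for each `ν ∈ S¹` and for every sequence of centers `{y_T}_T` the following properties
  hold: (i) If `z⁺ = (θ,τ,1) ∈ 𝒵` and `z⁻ = 0` or if `z⁺ = 0` and `z⁻ = (θ,τ,1) ∈ 𝒵`, there holds for
  all `T > 0`: `|T⁻¹ min{E₁(X_T, Q^ν_T(y_T)) : X_T = 𝓛(z^±) on ∂^±_1 Q^ν_T(y_T)} − ϕ_hex(e^{−iθ}ν)| ≤ C/T`.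
  (ii) For all `z⁺ = (θ⁺,τ⁺,1)`, `z⁻ = (θ⁻,τ⁻,1) ∈ 𝒵` there holds for all `T > 0`:
  `T⁻¹ min{…} ≤ ϕ_hex(e^{−iθ⁺}ν) + ϕ_hex(e^{−iθ⁻}ν) + C/T`.  Moreover, if `z⁺ ≠ z⁻`, then also
  `T⁻¹ min{…} ≥ ½ϕ_hex(e^{−iθ⁺}ν) + ½ϕ_hex(e^{−iθ⁻}ν) − C/T`."
* p. 674, (6.2): the good angles `G_𝒜` are "the angles `θ ∈ 𝒜` which can be written as
  `e^{iθ} = v₁/v₂`, with `v₁, v₂ ∈ 𝓛∖{0}`" — "Note that `G_𝒜` is clearly countable."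

## PRINT NOTE (normalisation of `ϕ_hex`; seat finding, recorded for the referee)

With `E_ε` as printed in (1.3)/(2.3) (prefactor `½·ε`; (1.3) is `(E(X_N)+3N)/√N`) the solid–vacuum
limit of the cell problem (2.16) is `½ϕ_hex`, not `ϕ_hex`: for `ν = i`, `θ = 0` the half-lattice
`𝓛 ∩ {Im ≥ 5}` is the competitor (6.9) of the printed proof; its boundary row has four neighbours per
atom, energy `½·1·2 = 1` per atom, one atom per unit length, so `T⁻¹E₁ → 1`, while
`ϕ_hex(i) = (2/√3)(√3/2 + √3/2 + 0) = 2`.  Independently, by (1.2) the normalized ground-state energy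
tends to `√12 = 2√3`, which is the `½ϕ_hex`-perimeter of the Wulff hexagon of area `√3/2` (the area
of `N` Voronoi cells of side `ε/√3`, cf. Prop. 3.3): perimeter `2√3`, facet density `½ϕ_hex = 1`;
density `ϕ_hex` would give `4√3`.  The factor is lost in the slicing step (6.6), p. 675, "By (2.3) this
yields `E₁ ≥ Σ_k #I_k − C`": each lattice line crossing the interface carries ONE missing bond,
of energy `½` under (2.3).  `ϕ_hex` of (2.18) is the density `Γ` of [3] = Au Yeung–Friesecke–Schmidt
(2012), whose energy `Σ_{i≠j} V` counts ordered pairs, i.e. equals `2E`.  The arXiv v2 and the journal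
text agree verbatim on (1.3), (2.3), (2.18), Theorem 2.5 and Lemma 6.1.  We therefore vendor (2.3)
and (2.18) VERBATIM (`localEnergy`, `phiHex`) and state Theorem 2.5 (i)–(ii) and Lemma 6.1 — the only
statements in which `ϕ_hex` is compared with the cell energy — with every `ϕ_hex` replaced by
`½ϕ_hex`, which is what the printed proofs establish for the printed `E_ε`.  All RATIOS are as
printed: a generic grain boundary costs the sum of the two free surfaces, every grain boundary at
least half of it (the two-dimensional print behind the charges `c₀ = 1`, `c₁ = ½` of the venture's
wall laws).  Proposition 2.2, Theorem 2.5 (iii)–(v) and Lemma 5.1 contain no `ϕ_hex` and are typed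
verbatim.

## Rendering

* The plane is `ℂ` (the paper's own identification; also the setting of the tree's Heitmann–Radin /
  Harborth proof files `Literature/Geometry/DiscreteGeometry/HarborthInduction.lean` ff., whose
  `Harborth.nbrs` / `Harborth.IsHard` are the `ε = 1` cases of `nbrsAt` / `IsHardAt` here —
  `nbrsAt_one`, `isHardAt_one_iff`, both `rfl`).  `⟨x,y⟩` is the real inner product `⟪x, y⟫_ℝ` of `ℂ`,
  `e^{iθ}` is `rot θ = Complex.exp (θ I)`, `ν^⊥ = −iν` (`perp`).
* `𝒵` is rendered by REPRESENTATIVES: `Phase := Option (ℝ × ℂ)`, `none` = the vacuum `0`,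
  `some (θ, τ)` = the lattice `𝓛(θ,τ,1) = e^{iθ}(𝓛 + τ)` (`phaseLattice`).  The printed `z⁺ ≠ z⁻` (distinct
  elements of `𝒵`) is rendered as `phaseLattice z⁺ ≠ phaseLattice z⁻`; in Theorem 2.5 (ii), whose
  exceptional-set description uses the representatives (2.8), the pairs range over CANONICAL
  representatives `θ ∈ [0, π/3)`, `τ = λ₁ + λ₂ω`, `λ_i ∈ [0,1)` (`IsCanonical`), and "null for the Haar
  measure of `(𝒵∖{0})²`" becomes "Lebesgue-null in `(ℝ × ℂ)²`" for the set of canonical pairs.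
* A configuration is a `Finset ℂ`; `E_ε(X) < +∞` is the hard-core condition `IsHardAt ε X` (distinct
  atoms at distance `≥ ε`); the "min" in (2.16)/(5.3) is `cellMin` = `sInf` of the localized energies of
  the admissible configurations (`IsCellCompetitor`: hard core + the two boundary coincidences (2.10)
  on the layers (2.7)); a minimiser (Lemma 5.1) is an admissible configuration of least energy
  (`IsCellMinimizer`).
* `ϕ(z⁺,z⁻,ν)` is DEFINED here as `density z⁺ z⁻ ν := limsup_{ε→0⁺} cellMin ε z⁺ z⁻ ν 0 1` (centre `0`,
  `ρ = 1`); Proposition 2.2 is then the named fact that for every centre `x₀` and every `ρ > 0` the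
  rescaled minima `ρ⁻¹ cellMin ε z⁺ z⁻ ν x₀ ρ` CONVERGE to this number as `ε → 0⁺` (existence of the
  limit and independence of `x₀, ρ`).  Theorem 2.5 (iii) concerns the positively 1-homogeneous
  extension `densityHom`.

## What is here

Definitions with bodies: `omega`, `triLattice`, `rot`, `perp`, `Phase`, `phaseLattice`, `nbrsAt`,
`IsHardAt`, `localEnergy`, `unitSquare`, `square`, `upperLayer`, `lowerLayer`, `CoincidesOn`,
`IsCellCompetitor`, `cellMin`, `IsCellMinimizer`, `density`, `densityHom`, `phiHex`, `fundamentalCell`,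
`IsCanonical`, `goodAngles`, `IsBondConnected`.  Proved: `nbrsAt_one`, `isHardAt_one_iff`,
`card_nbrsAt_le_six` ((2.2), from the tree's `Harborth.card_nbrs_le_six` by scaling),
`localEnergy_nonneg`, `cellMin_nonneg`, `omega_sq`, `omega_pow_three`, `phiHex_I` (`ϕ_hex(i) = 2`),
`phiHex_nonneg`, `goodAngles_countable` ((6.2) "clearly countable"), the corollaries
`half_decohesion_le_density` / `density_le_decohesion` (every wall costs between one half of and the
full decohesion energy), and §8: `cellMin_rot`, `density_rot` and the DISCHARGE
`FriedrichKreutzSchmidt2021_rotationInvariant_holds` of Theorem 2.5 (iv) (rotating the cell problems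
about the origin).  NAMED FACTS (`def … : Prop`, never asserted): `FriedrichKreutzSchmidt2021_density`
(Prop. 2.2), `…_solidVacuum` (Thm 2.5 (i)), `…_solidSolid` (Thm 2.5 (ii)), `…_convex` (iii),
`…_rotationInvariant` (iv, discharged here), `…_translationInvariant` (v), `…_cellRate` (Lemma 6.1),
`…_twoLattices` (Lemma 5.1 (i)).

## What is not here

Theorem 2.1 (compactness) and Theorem 2.3 (`Γ`-convergence) — the state space (2.11)–(2.13)
`PC(ℝ²;𝒵) = {u ∈ SBV : ∇u = 0, …}` and the functional (2.17) on jump sets are not available in Mathlib;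
Lemma 5.1 (ii), Lemma 5.2, Theorem 5.4 (structure of grain boundaries as simple lattice paths),
Lemma 6.2 (touching lattices: optimal sequences with `Φ ≤ ϕ⁺ + ϕ⁻ − η` have angle difference in `G_𝒜`
with `e^{i(θ⁺−θ⁻)} = v₁/v₂`, `|v₁|,|v₂| ≤ C_η`) and Remark 2.6 (the exact value of `ϕ` on the exceptional
set "seems to be a difficult issue … a non-trivial number theoretic problem") — recorded, not typed.
No instances, no notation, no `sorry`.

## References

* M. Friedrich, L. Kreutz, B. Schmidt, ARMA **240** (2021) 627–698, doi:10.1007/s00205-021-01615-w,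
  arXiv:2006.01558. [FriedrichKreutzSchmidt2021]
* Y. Au Yeung, G. Friesecke, B. Schmidt, Calc. Var. PDE **44** (2012) 81–100 (the density `ϕ_hex`,
  ref. [3] of the source). [AuYeungFrieseckeSchmidt2012]
* R. C. Heitmann, C. Radin, J. Stat. Phys. **22** (1980) 281–287; H. Harborth, Elem. Math. **29** (1974)
  14–15 (tree: `Literature/Geometry/DiscreteGeometry/UnitDiscContactNumber.lean`, `…/UnitDiscBondAngles.lean`).
-/

noncomputable section

open scoped InnerProductSpace Topology Pointwise
open Complex Filter Set MeasureTheory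

namespace Literature.MathematicalPhysics.StatisticalMechanics.FriedrichKreutzSchmidt2021

open Literature.Geometry.DiscreteGeometry

/-! ### §1 The triangular lattice, rotated and translated lattices, the phase space `𝒵` -/

/-- `ω = ½ + (i/2)√3` [cite: FriedrichKreutzSchmidt2021, §2.2 p. 634]. -/
def omega : ℂ := ⟨1 / 2, Real.sqrt 3 / 2⟩

/-- The triangular lattice `𝓛 = {p + qω : p, q ∈ ℤ}` [cite: FriedrichKreutzSchmidt2021, §2.2 p. 634]. -/
def triLattice : Set ℂ := {z | ∃ p q : ℤ, z = (p : ℂ) + (q : ℂ) * omega}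

/-- The rotation `e^{iθ}` as a unit complex number [cite: FriedrichKreutzSchmidt2021, §2.2 p. 633 (Notation)]. -/
def rot (θ : ℝ) : ℂ := Complex.exp ((θ : ℂ) * I)

/-- `ν^⊥`: the vector `ν` rotated by `π/2` in the CLOCKWISE sense, i.e. `−iν`
[cite: FriedrichKreutzSchmidt2021, §2.2 p. 633 (Notation)]. -/
def perp (ν : ℂ) : ℂ := -I * ν

/-- The phase space `𝒵 = (𝒜 × 𝒯 × {1}) ∪ {0}` (2.9), rendered by representatives: `none` is the vacuum `0`,
`some (θ, τ)` the rotated and translated lattice `𝓛(θ, τ, 1)` (`θ ∈ ℝ` represents a class of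
`𝒜 = ℝ/(π/3)ℤ`, `τ ∈ ℂ` a class of `𝒯 = ℂ/𝓛`) [cite: FriedrichKreutzSchmidt2021, (2.9) p. 634]. -/
abbrev Phase : Type := Option (ℝ × ℂ)

/-- `𝓛(z)`: `𝓛(0) = ∅` and `𝓛(θ,τ,1) = e^{iθ}(𝓛 + τ)` [cite: FriedrichKreutzSchmidt2021, (2.9) p. 634]. -/
def phaseLattice : Phase → Set ℂ
  | none => ∅
  | some p => {x | ∃ v ∈ triLattice, x = rot p.1 * (v + p.2)}

/-- The vacuum has no atoms: `𝓛(0) = ∅` [cite: FriedrichKreutzSchmidt2021, (2.9) p. 634]. -/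
@[simp] theorem phaseLattice_none : phaseLattice none = ∅ := rfl

/-- Unfolding of `𝓛(θ,τ,1) = e^{iθ}(𝓛 + τ)` [cite: FriedrichKreutzSchmidt2021, (2.9) p. 634]. -/
theorem mem_phaseLattice_some {θ : ℝ} {τ x : ℂ} :
    x ∈ phaseLattice (some (θ, τ)) ↔ ∃ v ∈ triLattice, x = rot θ * (v + τ) := Iff.rfl

/-! ### §2 Neighbourhoods, hard core, the localized energy (2.1)–(2.3) -/

/-- `N_ε(x) = {y ∈ X : |x − y| = ε}`, the neighbourhood of `x` at atomic spacing `ε`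
[cite: FriedrichKreutzSchmidt2021, (2.1) p. 632]. -/
def nbrsAt (ε : ℝ) (X : Finset ℂ) (x : ℂ) : Finset ℂ := X.filter fun y => ‖y - x‖ = ε

/-- Finite energy `E_ε(X) < +∞` (1.1)/(1.3): distinct atoms are at distance `≥ ε` (hard core)
[cite: FriedrichKreutzSchmidt2021, (1.1) p. 628 and (2.2) p. 633]. -/
def IsHardAt (ε : ℝ) (X : Finset ℂ) : Prop := ∀ x ∈ X, ∀ y ∈ X, x ≠ y → ε ≤ ‖y - x‖

/-- The localized energy `E_ε(X, B) = ½ Σ_{x ∈ X ∩ B} ε (6 − #N_ε(x))` (verbatim, prefactor `½`; see the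
PRINT NOTE in the module docstring) [cite: FriedrichKreutzSchmidt2021, (2.3) p. 633]. -/
def localEnergy (ε : ℝ) (X : Finset ℂ) (B : Set ℂ) : ℝ :=
  1 / 2 * ∑ x ∈ X, B.indicator (fun y => ε * (6 - ((nbrsAt ε X y).card : ℝ))) x

/-- At `ε = 1` the neighbourhood is the tree's `Harborth.nbrs` (unit-distance neighbours)
[cite: FriedrichKreutzSchmidt2021, (2.1) p. 632]. -/
theorem nbrsAt_one (X : Finset ℂ) (x : ℂ) : nbrsAt 1 X x = Harborth.nbrs X x := rfl

/-- At `ε = 1` the hard-core condition is the tree's `Harborth.IsHard`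
[cite: FriedrichKreutzSchmidt2021, (1.1) p. 628]. -/
theorem isHardAt_one_iff (X : Finset ℂ) : IsHardAt 1 X ↔ Harborth.IsHard X := Iff.rfl

/-- **(2.2)**: in a finite-energy configuration every atom has at most six neighbours — by scaling
`x ↦ ε⁻¹x` from the tree's PROVED `Harborth.card_nbrs_le_six` ("jeder Kreis wird von höchstens sechs
anderen berührt"). [cite: FriedrichKreutzSchmidt2021, (2.2) p. 633] -/
theorem card_nbrsAt_le_six {ε : ℝ} (hε : 0 < ε) {X : Finset ℂ} (hX : IsHardAt ε X) (x : ℂ) :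
    (nbrsAt ε X x).card ≤ 6 := by
  classical
  set c : ℂ := ((ε⁻¹ : ℝ) : ℂ) with hc
  have hcn : ‖c‖ = ε⁻¹ := by
    rw [hc, Complex.norm_real, Real.norm_eq_abs, abs_of_pos (inv_pos.2 hε)]
  have hc0 : c ≠ 0 := by
    intro h
    have : ‖c‖ = 0 := by rw [h, norm_zero]
    rw [hcn] at this
    exact (inv_pos.2 hε).ne' this
  let f : ℂ ↪ ℂ := ⟨fun z => c * z, mul_right_injective₀ hc0⟩
  have hscale : ∀ y z : ℂ, ‖f y - f z‖ = ε⁻¹ * ‖y - z‖ := by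
    intro y z
    show ‖c * y - c * z‖ = ε⁻¹ * ‖y - z‖
    rw [← mul_sub, norm_mul, hcn]
  have hhard : Harborth.IsHard (X.map f) := by
    intro p hp q hq hpq
    obtain ⟨p', hp', rfl⟩ := Finset.mem_map.1 hp
    obtain ⟨q', hq', rfl⟩ := Finset.mem_map.1 hq
    have hne : p' ≠ q' := fun h => hpq (by rw [h])
    have h1 := hX p' hp' q' hq' hne
    rw [hscale]
    calc (1 : ℝ) = ε⁻¹ * ε := by rw [inv_mul_cancel₀ hε.ne']
      _ ≤ ε⁻¹ * ‖q' - p'‖ := mul_le_mul_of_nonneg_left h1 (inv_pos.2 hε).le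
  have hsub : (nbrsAt ε X x).map f ⊆ Harborth.nbrs (X.map f) (f x) := by
    intro q hq
    obtain ⟨q', hq', rfl⟩ := Finset.mem_map.1 hq
    rw [nbrsAt, Finset.mem_filter] at hq'
    rw [Harborth.mem_nbrs]
    refine ⟨Finset.mem_map_of_mem f hq'.1, ?_⟩
    rw [hscale, hq'.2, inv_mul_cancel₀ hε.ne']
  calc (nbrsAt ε X x).card = ((nbrsAt ε X x).map f).card := (Finset.card_map f).symm
    _ ≤ (Harborth.nbrs (X.map f) (f x)).card := Finset.card_le_card hsub
    _ ≤ 6 := Harborth.card_nbrs_le_six hhard (f x)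

/-- The localized energy of a finite-energy configuration is nonnegative (each summand
`ε(6 − #N_ε(x)) ≥ 0` by (2.2)). [cite: FriedrichKreutzSchmidt2021, (2.2)–(2.3) p. 633] -/
theorem localEnergy_nonneg {ε : ℝ} (hε : 0 < ε) {X : Finset ℂ} (hX : IsHardAt ε X) (B : Set ℂ) :
    0 ≤ localEnergy ε X B := by
  unfold localEnergy
  refine mul_nonneg (by norm_num) (Finset.sum_nonneg fun x _ => ?_)
  refine Set.indicator_nonneg (fun y _ => mul_nonneg hε.le ?_) x
  have h6 : ((nbrsAt ε X y).card : ℝ) ≤ 6 := by exact_mod_cast card_nbrsAt_le_six hε hX y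
  linarith

/-! ### §3 Cubes, boundary layers, the cell problem (2.6)–(2.7), (2.10), (2.16) -/

/-- The half-open unit square `Q^ν = {y : −½ ≤ ⟨y,ν⟩ < ½, −½ ≤ ⟨y,ν^⊥⟩ < ½}` with two sides parallel
to `ν` [cite: FriedrichKreutzSchmidt2021, §2.2 p. 633]. -/
def unitSquare (ν : ℂ) : Set ℂ :=
  {y | -(1 / 2 : ℝ) ≤ ⟪y, ν⟫_ℝ ∧ ⟪y, ν⟫_ℝ < 1 / 2 ∧ -(1 / 2 : ℝ) ≤ ⟪y, perp ν⟫_ℝ ∧ ⟪y, perp ν⟫_ℝ < 1 / 2}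

/-- The cube `Q^ν_ρ(x) := x + ρQ^ν` [cite: FriedrichKreutzSchmidt2021, §2.2 p. 634]. -/
def square (ν x : ℂ) (ρ : ℝ) : Set ℂ := {y | y - x ∈ ρ • unitSquare ν}

/-- The upper boundary layer `∂^+_ε Q^ν_ρ(x) = x + {y ∈ Q^ν_{ρ+10ε} ∖ Q^ν_{ρ−10ε} : ⟨ν, y⟩ ≥ 5ε}`
[cite: FriedrichKreutzSchmidt2021, (2.7) p. 634]. -/
def upperLayer (ε : ℝ) (ν x : ℂ) (ρ : ℝ) : Set ℂ :=
  {y | y - x ∈ (ρ + 10 * ε) • unitSquare ν ∧ y - x ∉ (ρ - 10 * ε) • unitSquare ν ∧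
    5 * ε ≤ ⟪ν, y - x⟫_ℝ}

/-- The lower boundary layer `∂^−_ε Q^ν_ρ(x) = x + {y ∈ Q^ν_{ρ+10ε} ∖ Q^ν_{ρ−10ε} : −⟨ν, y⟩ ≥ 5ε}`
[cite: FriedrichKreutzSchmidt2021, (2.7) p. 634]. -/
def lowerLayer (ε : ℝ) (ν x : ℂ) (ρ : ℝ) : Set ℂ :=
  {y | y - x ∈ (ρ + 10 * ε) • unitSquare ν ∧ y - x ∉ (ρ - 10 * ε) • unitSquare ν ∧
    5 * ε ≤ -⟪ν, y - x⟫_ℝ}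

/-- `X = ε𝓛(z)` on `A`: `X ∩ A = (ε𝓛(z)) ∩ A` [cite: FriedrichKreutzSchmidt2021, (2.10) p. 634]. -/
def CoincidesOn (X : Finset ℂ) (ε : ℝ) (z : Phase) (A : Set ℂ) : Prop :=
  (↑X : Set ℂ) ∩ A = ε • phaseLattice z ∩ A

/-- The admissible configurations of the cell problem (2.16) on `Q^ν_ρ(x₀)` at spacing `ε` with the
phases `z⁺` (upper) and `z⁻` (lower): finite energy (hard core at scale `ε`) and
`X = ε𝓛(z^±)` on `∂^±_ε Q^ν_ρ(x₀)` [cite: FriedrichKreutzSchmidt2021, (2.16) p. 636]. -/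
structure IsCellCompetitor (ε : ℝ) (zp zm : Phase) (ν x₀ : ℂ) (ρ : ℝ) (X : Finset ℂ) : Prop where
  hard : IsHardAt ε X
  upper : CoincidesOn X ε zp (upperLayer ε ν x₀ ρ)
  lower : CoincidesOn X ε zm (lowerLayer ε ν x₀ ρ)

/-- The cell minimum `min{E_ε(X, Q^ν_ρ(x₀)) : X = ε𝓛(z^±) on ∂^±_ε Q^ν_ρ(x₀)}` (rendered as the infimum
of the localized energies of the admissible configurations; "the minimum … exists since `E₁` is lower
semicontinuous … and the problem is finite dimensional", p. 663)
[cite: FriedrichKreutzSchmidt2021, (2.16) p. 636 and (5.3) p. 663]. -/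
def cellMin (ε : ℝ) (zp zm : Phase) (ν x₀ : ℂ) (ρ : ℝ) : ℝ :=
  sInf ((fun X : Finset ℂ => localEnergy ε X (square ν x₀ ρ)) '' {X | IsCellCompetitor ε zp zm ν x₀ ρ X})

/-- A minimiser of the cell problem: an admissible configuration whose localized energy is least
[cite: FriedrichKreutzSchmidt2021, (5.3) p. 663]. -/
def IsCellMinimizer (ε : ℝ) (zp zm : Phase) (ν x₀ : ℂ) (ρ : ℝ) (X : Finset ℂ) : Prop :=
  IsCellCompetitor ε zp zm ν x₀ ρ X ∧
    ∀ Y : Finset ℂ, IsCellCompetitor ε zp zm ν x₀ ρ Y →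
      localEnergy ε X (square ν x₀ ρ) ≤ localEnergy ε Y (square ν x₀ ρ)

/-- The cell minimum is nonnegative (all admissible energies are `≥ 0`; `sInf ∅ = 0`).
[cite: FriedrichKreutzSchmidt2021, (2.16) p. 636] -/
theorem cellMin_nonneg {ε : ℝ} (hε : 0 < ε) (zp zm : Phase) (ν x₀ : ℂ) (ρ : ℝ) :
    0 ≤ cellMin ε zp zm ν x₀ ρ := by
  refine Real.sInf_nonneg ?_
  rintro _ ⟨X, hX, rfl⟩
  exact localEnergy_nonneg hε hX.hard _

/-! ### §4 The density `ϕ` (Proposition 2.2) and the hexagonal density `ϕ_hex` (2.18) -/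

/-- The grain-boundary energy density `ϕ(z⁺, z⁻, ν)`, DEFINED as the upper limit as `ε → 0⁺` of the
cell minima on the unit cube centred at the origin; by Proposition 2.2 (the named fact
`FriedrichKreutzSchmidt2021_density`) it is the limit (2.16) for every centre and every `ρ > 0`
[cite: FriedrichKreutzSchmidt2021, Proposition 2.2 (2.16) p. 636]. -/
def density (zp zm : Phase) (ν : ℂ) : ℝ :=
  limsup (fun ε : ℝ => cellMin ε zp zm ν 0 1) (𝓝[>] (0 : ℝ))

/-- The positively 1-homogeneous extension of `ν ↦ ϕ(z⁺,z⁻,ν)` from `S¹` to `ℝ² = ℂ` (value `0` at `0`)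
[cite: FriedrichKreutzSchmidt2021, Theorem 2.5 (preamble) p. 638]. -/
def densityHom (zp zm : Phase) (ν : ℂ) : ℝ :=
  if ν = 0 then 0 else ‖ν‖ * density zp zm (((‖ν‖⁻¹ : ℝ) : ℂ) * ν)

/-- `ϕ_hex(ν) = (2/√3) Σ_{k=1}^{3} |⟨ν, ω^k⟩|` (verbatim; see the PRINT NOTE in the module docstring for
its normalisation relative to (2.3)) [cite: FriedrichKreutzSchmidt2021, (2.18) p. 638]. -/
def phiHex (ν : ℂ) : ℝ :=
  2 / Real.sqrt 3 * ∑ k ∈ Finset.range 3, |⟪ν, omega ^ (k + 1)⟫_ℝ|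

/-- `ϕ_hex ≥ 0`. [cite: FriedrichKreutzSchmidt2021, (2.18) p. 638] -/
theorem phiHex_nonneg (ν : ℂ) : 0 ≤ phiHex ν := by
  unfold phiHex
  refine mul_nonneg (div_nonneg (by norm_num) (Real.sqrt_nonneg _)) ?_
  exact Finset.sum_nonneg fun k _ => abs_nonneg _

/-- `ω² = ω − 1`. [cite: FriedrichKreutzSchmidt2021, §2.2 p. 634] -/
theorem omega_sq : omega ^ 2 = omega - 1 := by
  have h3 : Real.sqrt 3 * Real.sqrt 3 = 3 := Real.mul_self_sqrt (by norm_num)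
  apply Complex.ext <;> simp [omega, sq] <;> nlinarith [h3]

/-- `ω³ = −1` (`ω = e^{iπ/3}`). [cite: FriedrichKreutzSchmidt2021, §2.2 p. 634] -/
theorem omega_pow_three : omega ^ 3 = -1 := by
  have h3 : Real.sqrt 3 * Real.sqrt 3 = 3 := Real.mul_self_sqrt (by norm_num)
  rw [pow_succ, omega_sq]
  apply Complex.ext <;> simp [omega] <;> nlinarith [h3]

/-- Sanity value: `ϕ_hex(i) = (2/√3)(√3/2 + √3/2 + 0) = 2` — the direction normal to a close-packed row,
a vertex direction of the unit ball of `ϕ_hex` (p. 638: its vertices are `½e^{iπ/6}{±1,±ω,±ω²}`, and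
`i/2 = ½e^{iπ/6}ω` is one of them, so `ϕ_hex(i/2) = 1`). [cite: FriedrichKreutzSchmidt2021, (2.18) p. 638] -/
theorem phiHex_I : phiHex I = 2 := by
  have h3 : Real.sqrt 3 * Real.sqrt 3 = 3 := Real.mul_self_sqrt (by norm_num)
  have hs0 : 0 < Real.sqrt 3 := Real.sqrt_pos.2 (by norm_num)
  have e1 : omega ^ (0 + 1) = omega := by simp
  have e2 : omega ^ (1 + 1) = omega - 1 := by simpa using omega_sq
  have e3 : omega ^ (2 + 1) = -1 := by simpa using omega_pow_three
  have i1 : ⟪I, omega⟫_ℝ = Real.sqrt 3 / 2 := by simp [Complex.inner, omega]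
  have i2 : ⟪I, omega - 1⟫_ℝ = Real.sqrt 3 / 2 := by simp [Complex.inner, omega]
  have i3 : ⟪I, (-1 : ℂ)⟫_ℝ = 0 := by simp [Complex.inner]
  unfold phiHex
  rw [Finset.sum_range_succ, Finset.sum_range_succ, Finset.sum_range_succ, Finset.sum_range_zero,
    e1, e2, e3, i1, i2, i3]
  rw [abs_of_pos (by positivity), abs_zero]
  field_simp
  nlinarith [h3]

/-! ### §5 Canonical representatives (2.8), good angles (6.2), bond-connectedness -/

/-- The representatives (2.8) of `𝒯 = ℂ/𝓛`: `λ₁ + λ₂ω` with `0 ≤ λ₁ < 1`, `0 ≤ λ₂ < 1`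
[cite: FriedrichKreutzSchmidt2021, (2.8) p. 634]. -/
def fundamentalCell : Set ℂ :=
  {τ | ∃ a b : ℝ, a ∈ Ico (0 : ℝ) 1 ∧ b ∈ Ico (0 : ℝ) 1 ∧ τ = (a : ℂ) + (b : ℂ) * omega}

/-- Canonical representative of an element `(θ, τ, 1) ∈ 𝒵∖{0}`: `θ ∈ [0, π/3)` (for `𝒜 = ℝ/(π/3)ℤ`)
and `τ` in the cell (2.8) [cite: FriedrichKreutzSchmidt2021, §2.2 (2.8)–(2.9) p. 634]. -/
def IsCanonical (p : ℝ × ℂ) : Prop := p.1 ∈ Ico (0 : ℝ) (Real.pi / 3) ∧ p.2 ∈ fundamentalCell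

/-- The good angles `G_𝒜` (6.2): rotations taking a lattice point to a lattice point,
`e^{iθ} = v₁/v₂` with `v₁, v₂ ∈ 𝓛∖{0}` (here as a subset of `ℝ`, i.e. all representatives)
[cite: FriedrichKreutzSchmidt2021, (6.2) p. 674]. -/
def goodAngles : Set ℝ :=
  {θ | ∃ v₁ ∈ triLattice, ∃ v₂ ∈ triLattice, v₁ ≠ 0 ∧ v₂ ≠ 0 ∧ rot θ = v₁ / v₂}

/-- "Note that `G_𝒜` is clearly countable" — PROVED: `G_𝒜` is covered by the countably many fibres
`{θ : e^{iθ} = (p+qω)/(r+sω)}`, `(p,q,r,s) ∈ ℤ⁴`, each of which is a translate of `2πℤ`.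
[cite: FriedrichKreutzSchmidt2021, (6.2) p. 674] -/
theorem goodAngles_countable : goodAngles.Countable := by
  have hfib : ∀ c : ℂ, ({θ : ℝ | rot θ = c} : Set ℝ).Countable := by
    intro c
    by_cases h : ∃ θ₀ : ℝ, rot θ₀ = c
    · obtain ⟨θ₀, hθ₀⟩ := h
      have hsub : {θ : ℝ | rot θ = c} ⊆ Set.range fun n : ℤ => θ₀ + n * (2 * Real.pi) := by
        intro θ hθ
        have he : Complex.exp ((θ : ℂ) * I) = Complex.exp ((θ₀ : ℂ) * I) := by
          rw [← rot, ← rot]; exact hθ.trans hθ₀.symm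
        obtain ⟨n, hn⟩ := Complex.exp_eq_exp_iff_exists_int.1 he
        refine ⟨n, ?_⟩
        have hre := congrArg Complex.im hn
        simp at hre
        linarith
      exact (Set.countable_range _).mono hsub
    · have : {θ : ℝ | rot θ = c} = ∅ := by
        ext θ
        simp only [Set.mem_setOf_eq, Set.mem_empty_iff_false, iff_false]
        exact fun hθ => h ⟨θ, hθ⟩
      rw [this]
      exact Set.countable_empty
  let F : ℤ × ℤ × ℤ × ℤ → Set ℝ := fun k =>
    {θ : ℝ | rot θ = ((k.1 : ℂ) + (k.2.1 : ℂ) * omega) / ((k.2.2.1 : ℂ) + (k.2.2.2 : ℂ) * omega)}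
  have hsub : goodAngles ⊆ ⋃ k, F k := by
    rintro θ ⟨v₁, ⟨p, q, rfl⟩, v₂, ⟨r, s, rfl⟩, -, -, h⟩
    exact Set.mem_iUnion.2 ⟨(p, q, r, s), h⟩
  exact (Set.countable_iUnion fun k => hfib _).mono hsub

/-- Connectedness of a configuration through unit bonds: every two atoms are joined by a chain
`(v₁, …, v_n)` in `Y` with `|v_{i+1} − v_i| = 1` [cite: FriedrichKreutzSchmidt2021, §5 p. 662–663]. -/
def IsBondConnected (Y : Finset ℂ) : Prop :=
  ∀ x ∈ Y, ∀ y ∈ Y, Relation.ReflTransGen (fun a b : ℂ => a ∈ Y ∧ b ∈ Y ∧ ‖b - a‖ = 1) x y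

/-! ### §6 The named facts -/

/-- **Friedrich–Kreutz–Schmidt 2021, Proposition 2.2 (Density), NAMED FACT.**  For every
`z⁺, z⁻ ∈ 𝒵`, `ν ∈ S¹`, `x₀ ∈ ℝ²` and `ρ > 0` the rescaled cell minima
`ρ⁻¹ min{E_ε(X, Q^ν_ρ(x₀)) : X = ε𝓛(z^±) on ∂^±_ε Q^ν_ρ(x₀)}` converge as `ε → 0`, to a limit
`ϕ(z⁺,z⁻,ν)` independent of `x₀` and `ρ` (rendered: they converge to `density z⁺ z⁻ ν`, the upper
limit at `x₀ = 0`, `ρ = 1`). [cite: FriedrichKreutzSchmidt2021, Proposition 2.2 (2.16) p. 636] -/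
def FriedrichKreutzSchmidt2021_density : Prop :=
  ∀ (zp zm : Phase) (ν x₀ : ℂ) (ρ : ℝ), ‖ν‖ = 1 → 0 < ρ →
    Tendsto (fun ε : ℝ => ρ⁻¹ * cellMin ε zp zm ν x₀ ρ) (𝓝[>] (0 : ℝ)) (𝓝 (density zp zm ν))

/-- **Friedrich–Kreutz–Schmidt 2021, Theorem 2.5 (i) (Solid–vacuum energy), NAMED FACT** — with the
normalisation of the PRINT NOTE (module docstring): for the energy (2.3) the solid–vacuum density is
`ϕ(z,0,ν) = ϕ(0,z,ν) = ½ϕ_hex(e^{−iθ}ν)` for all `z = (θ,τ,1)` and `ν ∈ S¹` (printed: `ϕ_hex(e^{−iθ}ν)`,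
which is the value for the energy without the prefactor `½`, i.e. for `Σ_{i≠j}V` as in [3]).
[cite: FriedrichKreutzSchmidt2021, Theorem 2.5 (i) p. 638; (2.3) p. 633; (2.18) p. 638] -/
def FriedrichKreutzSchmidt2021_solidVacuum : Prop :=
  ∀ (θ : ℝ) (τ ν : ℂ), ‖ν‖ = 1 →
    density (some (θ, τ)) none ν = 1 / 2 * phiHex (rot (-θ) * ν) ∧
      density none (some (θ, τ)) ν = 1 / 2 * phiHex (rot (-θ) * ν)

/-- **Friedrich–Kreutz–Schmidt 2021, Theorem 2.5 (ii) (Solid–solid energy), NAMED FACT** — over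
canonical representatives (2.8)–(2.9) and with the normalisation of the PRINT NOTE (every printed
`ϕ_hex` read as `½ϕ_hex` for the energy (2.3)).  There is a Lebesgue-null set `N` of pairs of canonical
representatives such that: off `N`, two DISTINCT lattices have grain-boundary density equal to the
sum of their two solid–vacuum densities, `ϕ(z⁺,z⁻,ν) = ½ϕ_hex(e^{−iθ⁺}ν) + ½ϕ_hex(e^{−iθ⁻}ν)`; on `N`
(distinct lattices) `¼ϕ_hex(e^{−iθ⁺}ν) + ¼ϕ_hex(e^{−iθ⁻}ν) ≤ ϕ(z⁺,z⁻,ν) < ½ϕ_hex(e^{−iθ⁺}ν) + ½ϕ_hex(e^{−iθ⁻}ν)`;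
and `N ⊆ {θ⁺ − θ⁻ ∈ G_𝒜, e^{iθ⁺}τ⁺ − e^{iθ⁻}τ⁻ ∈ G_𝒯(θ⁺ − θ⁻)}` for a countable set of angles `G_𝒜` and
sets `G_𝒯(θ)` each contained in a finite union of spheres.
[cite: FriedrichKreutzSchmidt2021, Theorem 2.5 (ii) p. 638; (2.8)–(2.9) p. 634; (2.3) p. 633] -/
def FriedrichKreutzSchmidt2021_solidSolid : Prop :=
  ∃ N : Set ((ℝ × ℂ) × (ℝ × ℂ)), volume N = 0 ∧ (∀ p ∈ N, IsCanonical p.1 ∧ IsCanonical p.2) ∧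
    (∀ p : (ℝ × ℂ) × (ℝ × ℂ), IsCanonical p.1 → IsCanonical p.2 → p ∉ N →
      phaseLattice (some p.1) ≠ phaseLattice (some p.2) → ∀ ν : ℂ, ‖ν‖ = 1 →
        density (some p.1) (some p.2) ν =
          1 / 2 * phiHex (rot (-p.1.1) * ν) + 1 / 2 * phiHex (rot (-p.2.1) * ν)) ∧
    (∀ p ∈ N, phaseLattice (some p.1) ≠ phaseLattice (some p.2) → ∀ ν : ℂ, ‖ν‖ = 1 →
        1 / 4 * phiHex (rot (-p.1.1) * ν) + 1 / 4 * phiHex (rot (-p.2.1) * ν) ≤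
            density (some p.1) (some p.2) ν ∧
          density (some p.1) (some p.2) ν <
            1 / 2 * phiHex (rot (-p.1.1) * ν) + 1 / 2 * phiHex (rot (-p.2.1) * ν)) ∧
    (∃ GA : Set ℝ, GA.Countable ∧ ∃ GT : ℝ → Set ℂ,
      (∀ θ : ℝ, ∃ S : Finset (ℂ × ℝ), GT θ ⊆ ⋃ c ∈ S, Metric.sphere c.1 c.2) ∧
        N ⊆ {p | p.1.1 - p.2.1 ∈ GA ∧
          rot p.1.1 * p.1.2 - rot p.2.1 * p.2.2 ∈ GT (p.1.1 - p.2.1)})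

/-- **Friedrich–Kreutz–Schmidt 2021, Theorem 2.5 (iii) (Convexity), NAMED FACT.**  For all
`z⁺, z⁻ ∈ 𝒵` the positively 1-homogeneous extension `ν ↦ ϕ(z⁺,z⁻,ν)` is convex on `ℝ²`.
[cite: FriedrichKreutzSchmidt2021, Theorem 2.5 (iii) p. 638] -/
def FriedrichKreutzSchmidt2021_convex : Prop :=
  ∀ zp zm : Phase, ConvexOn ℝ Set.univ (densityHom zp zm)

/-- **Friedrich–Kreutz–Schmidt 2021, Theorem 2.5 (iv) (Rotational invariance), NAMED FACT.**  For all
`z^± = (θ^±, τ^±, 1)`, `ν ∈ S¹` and `θ`: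
`ϕ((θ⁺+θ, τ⁺, 1), (θ⁻+θ, τ⁻, 1), e^{iθ}ν) = ϕ((θ⁺,τ⁺,1), (θ⁻,τ⁻,1), ν)`.
[cite: FriedrichKreutzSchmidt2021, Theorem 2.5 (iv) p. 638] -/
def FriedrichKreutzSchmidt2021_rotationInvariant : Prop :=
  ∀ (θp θm θ : ℝ) (τp τm ν : ℂ), ‖ν‖ = 1 →
    density (some (θp + θ, τp)) (some (θm + θ, τm)) (rot θ * ν) =
      density (some (θp, τp)) (some (θm, τm)) ν

/-- **Friedrich–Kreutz–Schmidt 2021, Theorem 2.5 (v) (Translational invariance), NAMED FACT.**  For all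
`z^± = (θ^±, τ^±, 1)`, `ν ∈ S¹` and `τ`:
`ϕ((θ⁺, τ⁺ + e^{−iθ⁺}τ, 1), (θ⁻, τ⁻ + e^{−iθ⁻}τ, 1), ν) = ϕ((θ⁺,τ⁺,1), (θ⁻,τ⁻,1), ν)`.
[cite: FriedrichKreutzSchmidt2021, Theorem 2.5 (v) p. 638] -/
def FriedrichKreutzSchmidt2021_translationInvariant : Prop :=
  ∀ (θp θm : ℝ) (τp τm τ ν : ℂ), ‖ν‖ = 1 →
    density (some (θp, τp + rot (-θp) * τ)) (some (θm, τm + rot (-θm) * τ)) ν =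
      density (some (θp, τp)) (some (θm, τm)) ν

/-- **Friedrich–Kreutz–Schmidt 2021, Lemma 6.1 (Relation of the cell formula and `ϕ_hex`), NAMED FACT**
— at atomic spacing `1` on cubes `Q^ν_T(y)` of side `T`, arbitrary centres `y`, with the normalisation
of the PRINT NOTE (printed `ϕ_hex` read as `½ϕ_hex` for the energy (2.3)).  There is a universal `C` such
that for all `ν ∈ S¹`, `y`, `T > 0`: (i) for a lattice against the vacuum (either side)
`|T⁻¹ min − ½ϕ_hex(e^{−iθ}ν)| ≤ C/T`; (ii) for two lattices `T⁻¹ min ≤ ½ϕ_hex(e^{−iθ⁺}ν) + ½ϕ_hex(e^{−iθ⁻}ν) + C/T`,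
and if the lattices are distinct `T⁻¹ min ≥ ¼ϕ_hex(e^{−iθ⁺}ν) + ¼ϕ_hex(e^{−iθ⁻}ν) − C/T`.
[cite: FriedrichKreutzSchmidt2021, Lemma 6.1 p. 673; (2.3) p. 633] -/
def FriedrichKreutzSchmidt2021_cellRate : Prop :=
  ∃ C : ℝ, ∀ (ν y : ℂ) (T : ℝ), ‖ν‖ = 1 → 0 < T →
    (∀ (θ : ℝ) (τ : ℂ),
      |T⁻¹ * cellMin 1 (some (θ, τ)) none ν y T - 1 / 2 * phiHex (rot (-θ) * ν)| ≤ C / T ∧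
        |T⁻¹ * cellMin 1 none (some (θ, τ)) ν y T - 1 / 2 * phiHex (rot (-θ) * ν)| ≤ C / T) ∧
    (∀ (θp θm : ℝ) (τp τm : ℂ),
      T⁻¹ * cellMin 1 (some (θp, τp)) (some (θm, τm)) ν y T ≤
          1 / 2 * phiHex (rot (-θp) * ν) + 1 / 2 * phiHex (rot (-θm) * ν) + C / T ∧
        (phaseLattice (some (θp, τp)) ≠ phaseLattice (some (θm, τm)) →
          1 / 4 * phiHex (rot (-θp) * ν) + 1 / 4 * phiHex (rot (-θm) * ν) - C / T ≤
            T⁻¹ * cellMin 1 (some (θp, τp)) (some (θm, τm)) ν y T))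

/-- **Friedrich–Kreutz–Schmidt 2021, Lemma 5.1 (i) (Reduction to subsets of two lattices), NAMED
FACT.**  At atomic spacing `1`, every minimiser `X` of the cell problem (5.3) on `Q^ν_T(y)` with
boundary phases `z^±` coincides on the cube with a union `X⁺ ∪ X⁻` of two bond-connected
configurations `X^± ⊂ 𝓛(z^±)` (for the vacuum `𝓛(0) = ∅`): the brittle set-up "does not support
interpolating boundary layers". [cite: FriedrichKreutzSchmidt2021, Lemma 5.1 (i) p. 663] -/
def FriedrichKreutzSchmidt2021_twoLattices : Prop :=
  ∀ (zp zm : Phase) (ν y : ℂ) (T : ℝ), ‖ν‖ = 1 → 0 < T → ∀ X : Finset ℂ,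
    IsCellMinimizer 1 zp zm ν y T X →
      ∃ Xp Xm : Finset ℂ, (↑Xp : Set ℂ) ⊆ phaseLattice zp ∧ (↑Xm : Set ℂ) ⊆ phaseLattice zm ∧
        IsBondConnected Xp ∧ IsBondConnected Xm ∧
          (↑X : Set ℂ) ∩ square ν y T = (↑Xp ∪ ↑Xm) ∩ square ν y T

/-! ### §7 Corollaries in the consumed form (PROVED from the named facts) -/

/-- From Theorem 2.5 (i)–(ii): EVERY grain boundary between two distinct lattices costs at least one
half of the decohesion energy (the sum of the two solid–vacuum densities) — for all canonical pairs,
exceptional or not. This is the two-dimensional print behind the charge `c₁ = ½` of the venture's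
`CoaxialWallLaw`. [cite: FriedrichKreutzSchmidt2021, Theorem 2.5 (i)–(ii) p. 638] -/
theorem half_decohesion_le_density (h₁ : FriedrichKreutzSchmidt2021_solidVacuum)
    (h₂ : FriedrichKreutzSchmidt2021_solidSolid) {p : (ℝ × ℂ) × (ℝ × ℂ)} (hp₁ : IsCanonical p.1)
    (hp₂ : IsCanonical p.2) (hne : phaseLattice (some p.1) ≠ phaseLattice (some p.2)) {ν : ℂ}
    (hν : ‖ν‖ = 1) :
    1 / 2 * (density (some p.1) none ν + density none (some p.2) ν) ≤
      density (some p.1) (some p.2) ν := by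
  obtain ⟨N, -, -, hoff, hon, -⟩ := h₂
  have e₁ : density (some p.1) none ν = 1 / 2 * phiHex (rot (-p.1.1) * ν) := by
    have := (h₁ p.1.1 p.1.2 ν hν).1
    simpa using this
  have e₂ : density none (some p.2) ν = 1 / 2 * phiHex (rot (-p.2.1) * ν) := by
    have := (h₁ p.2.1 p.2.2 ν hν).2
    simpa using this
  rw [e₁, e₂]
  by_cases hp : p ∈ N
  · have := (hon p hp hne ν hν).1
    linarith
  · have := hoff p hp₁ hp₂ hp hne ν hν
    rw [this]
    linarith [phiHex_nonneg (rot (-p.1.1) * ν), phiHex_nonneg (rot (-p.2.1) * ν)]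

/-- From Theorem 2.5 (i)–(ii): NO grain boundary costs more than the decohesion energy.
[cite: FriedrichKreutzSchmidt2021, Theorem 2.5 (i)–(ii) p. 638] -/
theorem density_le_decohesion (h₁ : FriedrichKreutzSchmidt2021_solidVacuum)
    (h₂ : FriedrichKreutzSchmidt2021_solidSolid) {p : (ℝ × ℂ) × (ℝ × ℂ)} (hp₁ : IsCanonical p.1)
    (hp₂ : IsCanonical p.2) (hne : phaseLattice (some p.1) ≠ phaseLattice (some p.2)) {ν : ℂ}
    (hν : ‖ν‖ = 1) :
    density (some p.1) (some p.2) ν ≤ density (some p.1) none ν + density none (some p.2) ν := by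
  obtain ⟨N, -, -, hoff, hon, -⟩ := h₂
  have e₁ : density (some p.1) none ν = 1 / 2 * phiHex (rot (-p.1.1) * ν) := by
    have := (h₁ p.1.1 p.1.2 ν hν).1
    simpa using this
  have e₂ : density none (some p.2) ν = 1 / 2 * phiHex (rot (-p.2.1) * ν) := by
    have := (h₁ p.2.1 p.2.2 ν hν).2
    simpa using this
  rw [e₁, e₂]
  by_cases hp : p ∈ N
  · exact (hon p hp hne ν hν).2.le
  · exact (hoff p hp₁ hp₂ hp hne ν hν).le

/-! ### §8 Theorem 2.5 (iv) (rotational invariance) — DISCHARGED from the definitions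

Rotating the whole cell problem about the origin by `e^{iθ}` maps the admissible configurations for the
phases `(θ^±, τ^±)` and normal `ν` bijectively onto those for `(θ^± + θ, τ^±)` and `e^{iθ}ν`, preserving
neighbourhoods and localized energies; the cell minima at centre `0` agree for every `ε`, hence so do
their upper limits `density`.  (The centre `0` is fixed by the rotation, so Proposition 2.2 is not
needed; translational invariance (v) would move the centre by `ετ` and is left as the named fact.) -/

section Rotation

/-- Rotating a phase by `θ`: `(θ', τ, 1) ↦ (θ' + θ, τ, 1)`, the vacuum is fixed
[cite: FriedrichKreutzSchmidt2021, Theorem 2.5 (iv) p. 638]. -/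
def rotPhase (θ : ℝ) : Phase → Phase
  | none => none
  | some p => some (p.1 + θ, p.2)

/-- `|e^{iθ}| = 1`. [cite: FriedrichKreutzSchmidt2021, §2.2 p. 633 (Notation)] -/
theorem norm_rot (θ : ℝ) : ‖rot θ‖ = 1 := by
  simp [rot, Complex.norm_exp_ofReal_mul_I]

/-- `e^{iθ} ≠ 0`. [cite: FriedrichKreutzSchmidt2021, §2.2 p. 633 (Notation)] -/
theorem rot_ne_zero (θ : ℝ) : rot θ ≠ 0 := by
  intro h
  have := norm_rot θ
  rw [h, norm_zero] at this
  exact zero_ne_one this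

/-- `e^{i(a+b)} = e^{ia}e^{ib}`. [cite: FriedrichKreutzSchmidt2021, §2.2 p. 633 (Notation)] -/
theorem rot_add (a b : ℝ) : rot (a + b) = rot a * rot b := by
  simp only [rot, Complex.ofReal_add, add_mul, Complex.exp_add]

/-- `e^{i0} = 1`. [cite: FriedrichKreutzSchmidt2021, §2.2 p. 633 (Notation)] -/
@[simp] theorem rot_zero : rot 0 = 1 := by simp [rot]

/-- `e^{−iθ}e^{iθ}ν = ν`. [cite: FriedrichKreutzSchmidt2021, §2.2 p. 633 (Notation)] -/
theorem rot_neg_mul_rot_mul (θ : ℝ) (ν : ℂ) : rot (-θ) * (rot θ * ν) = ν := by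
  rw [← mul_assoc, ← rot_add, neg_add_cancel, rot_zero, one_mul]

/-- `e^{iθ}e^{−iθ}ν = ν`. [cite: FriedrichKreutzSchmidt2021, §2.2 p. 633 (Notation)] -/
theorem rot_mul_rot_neg_mul (θ : ℝ) (ν : ℂ) : rot θ * (rot (-θ) * ν) = ν := by
  rw [← mul_assoc, ← rot_add, add_neg_cancel, rot_zero, one_mul]

/-- `e^{iθ} \overline{e^{iθ}} = 1`. [cite: FriedrichKreutzSchmidt2021, §2.2 p. 633 (Notation)] -/
theorem rot_mul_conj (θ : ℝ) : rot θ * (starRingEnd ℂ) (rot θ) = 1 := by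
  rw [Complex.mul_conj, Complex.normSq_eq_norm_sq, norm_rot]
  simp

/-- Rotations preserve the real inner product of the plane.
[cite: FriedrichKreutzSchmidt2021, §2.2 p. 633 (Notation)] -/
theorem inner_rot_mul_rot_mul (θ : ℝ) (x y : ℂ) : ⟪rot θ * x, rot θ * y⟫_ℝ = ⟪x, y⟫_ℝ := by
  rw [Complex.inner, Complex.inner, map_mul]
  have : rot θ * y * ((starRingEnd ℂ) (rot θ) * (starRingEnd ℂ) x) =
      (rot θ * (starRingEnd ℂ) (rot θ)) * (y * (starRingEnd ℂ) x) := by ring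
  rw [this, rot_mul_conj, one_mul]

/-- `(e^{iθ}ν)^⊥ = e^{iθ}ν^⊥`. [cite: FriedrichKreutzSchmidt2021, §2.2 p. 633 (Notation)] -/
theorem perp_rot_mul (θ : ℝ) (ν : ℂ) : perp (rot θ * ν) = rot θ * perp ν := by
  unfold perp; ring

/-- The rotated unit square: `Q^{e^{iθ}ν} = e^{iθ}Q^ν`. [cite: FriedrichKreutzSchmidt2021, §2.2 p. 633] -/
theorem unitSquare_rot (θ : ℝ) (ν : ℂ) :
    unitSquare (rot θ * ν) = (fun y => rot θ * y) '' unitSquare ν := by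
  ext y
  constructor
  · intro hy
    refine ⟨rot (-θ) * y, ?_, rot_mul_rot_neg_mul θ y⟩
    have hy' : rot θ * (rot (-θ) * y) ∈ unitSquare (rot θ * ν) := by
      rwa [rot_mul_rot_neg_mul]
    simp only [unitSquare, mem_setOf_eq, perp_rot_mul, inner_rot_mul_rot_mul] at hy'
    exact hy'
  · rintro ⟨y', hy', rfl⟩
    simp only [unitSquare, mem_setOf_eq, perp_rot_mul, inner_rot_mul_rot_mul] at hy' ⊢
    exact hy'

/-- Scaling commutes with rotating. [cite: FriedrichKreutzSchmidt2021, §2.2 p. 633] -/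
theorem image_rot_smul (θ ρ : ℝ) (S : Set ℂ) :
    (fun y => rot θ * y) '' (ρ • S) = ρ • ((fun y => rot θ * y) '' S) := by
  ext y
  simp only [Set.mem_image, Set.mem_smul_set]
  constructor
  · rintro ⟨_, ⟨s, hs, rfl⟩, rfl⟩
    refine ⟨rot θ * s, ⟨s, hs, rfl⟩, ?_⟩
    simp only [Complex.real_smul]; ring
  · rintro ⟨_, ⟨s, hs, rfl⟩, rfl⟩
    refine ⟨ρ • s, ⟨s, hs, rfl⟩, ?_⟩
    simp only [Complex.real_smul]; ring

/-- Membership in a rotated set. [cite: FriedrichKreutzSchmidt2021, §2.2 p. 633] -/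
theorem rot_mul_mem_image_iff (θ : ℝ) {S : Set ℂ} {y : ℂ} :
    rot θ * y ∈ (fun y => rot θ * y) '' S ↔ y ∈ S :=
  (mul_right_injective₀ (rot_ne_zero θ)).mem_set_image

/-- The rotated cube about the origin: `Q^{e^{iθ}ν}_ρ(0) = e^{iθ}Q^ν_ρ(0)`.
[cite: FriedrichKreutzSchmidt2021, §2.2 p. 634] -/
theorem square_rot (θ : ℝ) (ν : ℂ) (ρ : ℝ) :
    square (rot θ * ν) 0 ρ = (fun y => rot θ * y) '' square ν 0 ρ := by
  ext y
  simp only [square, sub_zero, mem_setOf_eq, unitSquare_rot, ← image_rot_smul]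
  constructor
  · rintro ⟨y', hy', rfl⟩; exact ⟨y', hy', rfl⟩
  · rintro ⟨y', hy', rfl⟩; exact ⟨y', hy', rfl⟩

/-- The rotated upper boundary layer about the origin. [cite: FriedrichKreutzSchmidt2021, (2.7) p. 634] -/
theorem upperLayer_rot (ε θ : ℝ) (ν : ℂ) (ρ : ℝ) :
    upperLayer ε (rot θ * ν) 0 ρ = (fun y => rot θ * y) '' upperLayer ε ν 0 ρ := by
  ext y
  simp only [upperLayer, sub_zero, mem_setOf_eq, unitSquare_rot, ← image_rot_smul]
  constructor
  · rintro ⟨⟨y', hy', rfl⟩, h2, h3⟩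
    refine ⟨y', ⟨hy', fun h => h2 ((rot_mul_mem_image_iff θ).2 h), ?_⟩, rfl⟩
    rwa [inner_rot_mul_rot_mul] at h3
  · rintro ⟨y', ⟨h1, h2, h3⟩, rfl⟩
    refine ⟨⟨y', h1, rfl⟩, fun h => h2 ((rot_mul_mem_image_iff θ).1 h), ?_⟩
    rwa [inner_rot_mul_rot_mul]

/-- The rotated lower boundary layer about the origin. [cite: FriedrichKreutzSchmidt2021, (2.7) p. 634] -/
theorem lowerLayer_rot (ε θ : ℝ) (ν : ℂ) (ρ : ℝ) :
    lowerLayer ε (rot θ * ν) 0 ρ = (fun y => rot θ * y) '' lowerLayer ε ν 0 ρ := by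
  ext y
  simp only [lowerLayer, sub_zero, mem_setOf_eq, unitSquare_rot, ← image_rot_smul]
  constructor
  · rintro ⟨⟨y', hy', rfl⟩, h2, h3⟩
    refine ⟨y', ⟨hy', fun h => h2 ((rot_mul_mem_image_iff θ).2 h), ?_⟩, rfl⟩
    rwa [inner_rot_mul_rot_mul] at h3
  · rintro ⟨y', ⟨h1, h2, h3⟩, rfl⟩
    refine ⟨⟨y', h1, rfl⟩, fun h => h2 ((rot_mul_mem_image_iff θ).1 h), ?_⟩
    rwa [inner_rot_mul_rot_mul]

/-- The rotated lattice: `𝓛(θ' + θ, τ, 1) = e^{iθ}𝓛(θ', τ, 1)`, `𝓛(0)` fixed.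
[cite: FriedrichKreutzSchmidt2021, (2.9) p. 634] -/
theorem phaseLattice_rotPhase (θ : ℝ) (z : Phase) :
    phaseLattice (rotPhase θ z) = (fun y => rot θ * y) '' phaseLattice z := by
  cases z with
  | none => simp [rotPhase, phaseLattice]
  | some p =>
    ext x
    simp only [rotPhase, phaseLattice, mem_setOf_eq, Set.mem_image]
    constructor
    · rintro ⟨v, hv, rfl⟩
      exact ⟨rot p.1 * (v + p.2), ⟨v, hv, rfl⟩, by rw [add_comm p.1 θ, rot_add]; ring⟩
    · rintro ⟨_, ⟨v, hv, rfl⟩, rfl⟩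
      exact ⟨v, hv, by rw [add_comm p.1 θ, rot_add]; ring⟩

variable (θ : ℝ)

/-- Multiplication by `e^{iθ}` as an embedding of `ℂ`. [cite: FriedrichKreutzSchmidt2021, §2.2 p. 633] -/
def rotEmb (θ : ℝ) : ℂ ↪ ℂ := ⟨fun y => rot θ * y, mul_right_injective₀ (rot_ne_zero θ)⟩

/-- Unfolding of `rotEmb`. [cite: FriedrichKreutzSchmidt2021, §2.2 p. 633] -/
@[simp] theorem rotEmb_apply (y : ℂ) : rotEmb θ y = rot θ * y := rfl

/-- Rotations are isometries: `|e^{iθ}y − e^{iθ}x| = |y − x|`.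
[cite: FriedrichKreutzSchmidt2021, §2.2 p. 633] -/
theorem norm_rot_mul_sub (x y : ℂ) : ‖rot θ * y - rot θ * x‖ = ‖y - x‖ := by
  rw [← mul_sub, norm_mul, norm_rot, one_mul]

/-- Neighbourhoods rotate. [cite: FriedrichKreutzSchmidt2021, (2.1) p. 632] -/
theorem nbrsAt_map_rotEmb (ε : ℝ) (X : Finset ℂ) (x : ℂ) :
    nbrsAt ε (X.map (rotEmb θ)) (rot θ * x) = (nbrsAt ε X x).map (rotEmb θ) := by
  ext y
  simp only [nbrsAt, Finset.mem_filter, Finset.mem_map, rotEmb_apply]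
  constructor
  · rintro ⟨⟨y', hy', rfl⟩, h⟩
    exact ⟨y', ⟨hy', by rwa [norm_rot_mul_sub] at h⟩, rfl⟩
  · rintro ⟨y', ⟨hy', h⟩, rfl⟩
    exact ⟨⟨y', hy', rfl⟩, by rwa [norm_rot_mul_sub]⟩

/-- The hard core rotates. [cite: FriedrichKreutzSchmidt2021, (2.2) p. 633] -/
theorem IsHardAt.map_rotEmb {ε : ℝ} {X : Finset ℂ} (hX : IsHardAt ε X) :
    IsHardAt ε (X.map (rotEmb θ)) := by
  intro p hp q hq hpq
  obtain ⟨p', hp', rfl⟩ := Finset.mem_map.1 hp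
  obtain ⟨q', hq', rfl⟩ := Finset.mem_map.1 hq
  rw [rotEmb_apply, rotEmb_apply, norm_rot_mul_sub]
  exact hX p' hp' q' hq' fun h => hpq (by rw [h])

/-- Localized energies rotate: `E_ε(e^{iθ}X, e^{iθ}B) = E_ε(X, B)`.
[cite: FriedrichKreutzSchmidt2021, (2.3) p. 633] -/
theorem localEnergy_map_rotEmb (ε : ℝ) (X : Finset ℂ) (B : Set ℂ) :
    localEnergy ε (X.map (rotEmb θ)) ((fun y => rot θ * y) '' B) = localEnergy ε X B := by
  unfold localEnergy
  congr 1
  rw [Finset.sum_map]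
  refine Finset.sum_congr rfl fun x _ => ?_
  rw [rotEmb_apply]
  by_cases hx : x ∈ B
  · rw [Set.indicator_of_mem hx, Set.indicator_of_mem ((rot_mul_mem_image_iff θ).2 hx),
      nbrsAt_map_rotEmb, Finset.card_map]
  · rw [Set.indicator_of_notMem hx,
      Set.indicator_of_notMem (fun h => hx ((rot_mul_mem_image_iff θ).1 h))]

/-- Coincidence with a lattice rotates. [cite: FriedrichKreutzSchmidt2021, (2.10) p. 634] -/
theorem CoincidesOn.map_rotEmb {X : Finset ℂ} {ε : ℝ} {z : Phase} {A : Set ℂ}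
    (h : CoincidesOn X ε z A) :
    CoincidesOn (X.map (rotEmb θ)) ε (rotPhase θ z) ((fun y => rot θ * y) '' A) := by
  have hinj : Function.Injective fun y : ℂ => rot θ * y := mul_right_injective₀ (rot_ne_zero θ)
  unfold CoincidesOn at h ⊢
  have e1 : (↑(X.map (rotEmb θ)) : Set ℂ) = (fun y => rot θ * y) '' ↑X := by
    rw [Finset.coe_map]; rfl
  rw [e1, phaseLattice_rotPhase, ← image_rot_smul, ← Set.image_inter hinj, ← Set.image_inter hinj, h]

/-- Admissible configurations rotate (centre `0`). [cite: FriedrichKreutzSchmidt2021, (2.16) p. 636] -/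
theorem IsCellCompetitor.map_rotEmb {ε : ℝ} {zp zm : Phase} {ν : ℂ} {ρ : ℝ} {X : Finset ℂ}
    (h : IsCellCompetitor ε zp zm ν 0 ρ X) :
    IsCellCompetitor ε (rotPhase θ zp) (rotPhase θ zm) (rot θ * ν) 0 ρ (X.map (rotEmb θ)) where
  hard := h.hard.map_rotEmb θ
  upper := by rw [upperLayer_rot]; exact h.upper.map_rotEmb θ
  lower := by rw [lowerLayer_rot]; exact h.lower.map_rotEmb θ

/-- The set of admissible energies is contained in that of the rotated problem.
[cite: FriedrichKreutzSchmidt2021, (2.16) p. 636] -/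
theorem energies_subset_rot (ε : ℝ) (zp zm : Phase) (ν : ℂ) (ρ : ℝ) :
    (fun X : Finset ℂ => localEnergy ε X (square ν 0 ρ)) '' {X | IsCellCompetitor ε zp zm ν 0 ρ X} ⊆
      (fun X : Finset ℂ => localEnergy ε X (square (rot θ * ν) 0 ρ)) ''
        {X | IsCellCompetitor ε (rotPhase θ zp) (rotPhase θ zm) (rot θ * ν) 0 ρ X} := by
  rintro _ ⟨X, hX, rfl⟩
  refine ⟨X.map (rotEmb θ), IsCellCompetitor.map_rotEmb θ hX, ?_⟩
  show localEnergy ε (X.map (rotEmb θ)) (square (rot θ * ν) 0 ρ) = localEnergy ε X (square ν 0 ρ)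
  rw [square_rot, localEnergy_map_rotEmb]

/-- Undoing a rotation of phases. [cite: FriedrichKreutzSchmidt2021, Theorem 2.5 (iv) p. 638] -/
theorem rotPhase_neg_rotPhase (z : Phase) : rotPhase (-θ) (rotPhase θ z) = z := by
  cases z with
  | none => rfl
  | some p => simp [rotPhase]

/-- **Cell minima are rotation invariant** (centre `0`, every `ε`): the admissible energies of the
problem and of its rotation coincide. [cite: FriedrichKreutzSchmidt2021, Theorem 2.5 (iv) p. 638] -/
theorem cellMin_rot (ε : ℝ) (zp zm : Phase) (ν : ℂ) (ρ : ℝ) :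
    cellMin ε (rotPhase θ zp) (rotPhase θ zm) (rot θ * ν) 0 ρ = cellMin ε zp zm ν 0 ρ := by
  unfold cellMin
  congr 1
  refine Set.Subset.antisymm ?_ (energies_subset_rot θ ε zp zm ν ρ)
  have h := energies_subset_rot (-θ) ε (rotPhase θ zp) (rotPhase θ zm) (rot θ * ν) ρ
  rwa [rotPhase_neg_rotPhase, rotPhase_neg_rotPhase, rot_neg_mul_rot_mul] at h

/-- **The density is rotation invariant**: `ϕ(e^{iθ}z⁺, e^{iθ}z⁻, e^{iθ}ν) = ϕ(z⁺, z⁻, ν)` for all phases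
(vacuum included). [cite: FriedrichKreutzSchmidt2021, Theorem 2.5 (iv) p. 638] -/
theorem density_rot (zp zm : Phase) (ν : ℂ) :
    density (rotPhase θ zp) (rotPhase θ zm) (rot θ * ν) = density zp zm ν := by
  unfold density
  simp_rw [cellMin_rot]

end Rotation

/-- **Theorem 2.5 (iv) DISCHARGED:** `FriedrichKreutzSchmidt2021_rotationInvariant` holds, by rotating the
cell problems about the origin (`cellMin_rot`). [cite: FriedrichKreutzSchmidt2021, Theorem 2.5 (iv) p. 638] -/
theorem FriedrichKreutzSchmidt2021_rotationInvariant_holds :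
    FriedrichKreutzSchmidt2021_rotationInvariant :=
  fun θp θm θ τp τm ν _ => density_rot θ (some (θp, τp)) (some (θm, τm)) ν

end Literature.MathematicalPhysics.StatisticalMechanics.FriedrichKreutzSchmidt2021

end
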